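import Mathlib
import HarnessLib
import HarnessLib.Audit
import Summits.HodgeConjecture.HodgeConjecture.Theses.EightfoldTwistedSheafSeeds
import Literature.AlgebraicGeometry.HodgeTheory.WeilFamilyReachSimilarOfSystem
import Literature.AlgebraicGeometry.HodgeTheory.WeilFamilyReachSimilar
import Literature.AlgebraicGeometry.HodgeTheory.WeilFamilyReach
import Literature.AlgebraicGeometry.HodgeTheory.WeilTypeAbelianVariety
import Literature.AlgebraicGeometry.HodgeTheory.WeilClassesRationalPlane
import Literature.AlgebraicGeometry.VanGeemen1994.WeilDiscriminantOfHyperbolic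
import Summits.HodgeConjecture.HodgeConjecture.Theorems.Ring2AbelianAllWeilSimilarDiscriminant
import Literature.AlgebraicGeometry.HodgeTheory.WeilFamilyReach

/-!
# Skeleton `Lines/moduli-riemann` for crux `ReachHyperbolic` (stmt-HodgeConjecture-18883)

HONEST FRAMING: a crux PROOF SKELETON (cruxes-workfile class), not a proof. The crux
`Theses.EightfoldTwistedSheafSeeds.ReachHyperbolic = weilFamilyReach_hyperbolic` (Deligne 1982, proof of Thm. 4.8 with
Cor. 4.2: two HYPERBOLIC members `(P, ψ₀)`, `(A, φ)` of Weil type `(n, n)` lie, up to `K`-isogeny, in ONE smooth projective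
family of abelian `2n`-folds with `√-d`-multiplication carrying a flat section of Weil classes — a refereed construction typed
as an open tree item, formalisation debt: the tree constructs no moduli space, no universal abelian scheme, no period map;
sibling of `SimilarReach`, stmt-23605, which implies it by `weilFamilyReach_hyperbolic_of_similar`) is NOT proved here: the `sorry`s sit exactly inside
the registered `stub_*` declarations. Nothing here proves K-C⁺, H2, HC_AV or HC.

STRATEGY (line-writer seat `linewriter-hodgeav-h2sheaf` g0, 2026-08-31) — ALGEBRAIC MODULI ⟂ TRANSCENDENTAL RIEMANN.
The venture's bridge (re-proved inline here from Literature theorems, the venture module being outside the farm build) `Summit.Ventures.HSemireg.weilFamilyReach_hyperbolic_of_polarizedWeilSystems_of_periodSurjective`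
derives the crux from ONE package (`PeriodPackage` below, its hypothesis VERBATIM): through every Weil-type point a polarized
Weil system (smooth projective family, `K`-action, flat Weil sections, polarization class) that is PERIOD-SURJECTIVE (clause
[U]: every Weil complex structure `J` on `H¹(P)` is the period of some fibre, with a `K`-marking `β`). The bridge itself
already contains the Torelli direction (`hodgeIso_bettiOne_isogeny`: an `H¹`-Hodge-isomorphism is a `K`-isogeny). The package
is ONE existential, so the only sound cut is by the two disciplines in Deligne's pp. 47–51:

* `stub_moduliComplete` — ALGEBRAIC (Riemann-free, XL): the universal family over a connected component of the PEL moduli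
  scheme with level structure EXISTS with all the listed properties, and is COMPLETE FOR REALISABLE PERIODS: every Weil complex
  structure `J` that is the `H¹` of SOME abelian variety `B` with `√-d`-multiplication (marked by `β_B`) is the period of a
  fibre ([MumfordFogartyKirwan1994] Thm. 7.9–7.10 fine moduli with level `m ≥ 3`; the transported Riemann form of `P`
  polarizes `B`; [Deligne1982HodgeCycles] pp. 48–51, Rem. 4.9; [vanGeemen1994HodgeAV] 5.8–5.11 for the flat sections).
* `stub_riemannRealisable` — TRANSCENDENTAL (XL): RIEMANN'S EXISTENCE THEOREM at Weil type — every Weil complex structure `J`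
  (positive for the `K`-hermitian form of the datum `weilDatumOfKsymm …`) is realised: `(H¹(P, ℚ), J)` is the `H¹` of an
  abelian variety `B` of dimension `2n` with an endomorphism `Φ`, `Φ² = -d`, intertwined with `ψ₀` by a marking `β`
  ([Mumford1970AbelianVarieties] §1–§3 (Lefschetz: a polarised torus is algebraic), [BirkenhakeLange2004] Thm. 4.2.1 / §4.5;
  Mathlib: no complex tori, no theta functions; tree: only the converse direction `hodgeIso_bettiOne_isogeny`).
* `periodPackage_of` (PROVED, sorry-free): moduli-complete ∧ Riemann-realisable ⟹ the period-surjective package (modus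
  ponens inside the existential; neither stub gives the package or the crux alone: the first has no realisability, the
  second no family).
* `stub_rung_riemannSurfaces` — RUNG (special case, first prover target): the transcendental stub at `n = 1` — Riemann
  realisability for Weil-type abelian SURFACES with `√-d`-multiplication (QM/CM surfaces over Shimura CURVES,
  [Shimura1963AnalyticFamilies] §4, [vanGeemen1994HodgeAV] §5): smaller, outside the tree's regime (the tree realises no
  weight-1 Hodge structure by an abelian variety). `subrung_of_stub` (sorry-free) shows it IS the special case. The
  crux-level surface rung (the reach statement at `n = 1`) is registered on the sibling `Cruxes/SimilarReach/Lines/moduli_riemann.lean`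
  (same seat), whose crux implies this one (`weilFamilyReach_hyperbolic_of_similar`).

COMPOSITION `ReachHyperbolic_of := hyperbolic_of_periodPackage (periodPackage_of stub_moduliComplete stub_riemannRealisable)`.

References: [Deligne1982HodgeCycles] §4 Prop. 4.4, Lemma 4.6, proof of Thm. 4.8 (pp. 47–52), Rem. 4.9;
[vanGeemen1994HodgeAV] Lemma 5.2, 5.3–5.5, 5.8–5.11; [MumfordFogartyKirwan1994] Thm. 7.9–7.10; [Mumford1970AbelianVarieties]
§1–§3; [BirkenhakeLange2004] Thm. 4.2.1; [Milne1986AbelianVarieties] §8 Prop. 8.1; [Landherr1936HermitianForms];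
[Shimura1963AnalyticFamilies].
-/

-- every declaration of this problem lives in `Summit.HodgeConjecture.HodgeConjecture.…` (summit = sub-problem)
set_option linter.dupNamespace false

noncomputable section

open CategoryTheory AlgebraicGeometry
open scoped TensorProduct
open Literature.AlgebraicGeometry Literature.AlgebraicGeometry.Motives
open Literature.AlgebraicGeometry.HodgeTheory
open Literature.AlgebraicGeometry.VanGeemen1994
open Literature.AlgebraicTopology.SingularHomology
open Summit.HodgeConjecture.HodgeConjecture.Ring2.AbelianAll

namespace Summit.HodgeConjecture.HodgeConjecture.Cruxes.ReachHyperbolic.ModuliRiemann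

/-- RIEMANN REALISABILITY of one Weil complex structure `J` on the datum of `(P, ψ₀, h_K, ω)`: `(H¹(P, ℚ), J)` is the `H¹` of
an abelian variety `B` of dimension `2n` with `Φ² = -d`, marked by `β` intertwining `ψ₀` and `Φ` and carrying the
`(1,0)`-piece of `J` into `H^{1,0}(B)`. [cite: Mumford1970AbelianVarieties, §1–§3] [cite: BirkenhakeLange2004, Thm. 4.2.1] -/
def RealisedBy (n d : ℕ) (P : AbelianVariety ℂ) (ψ₀ : P ⟶ P) (e : ProjectiveEmbedding P.X)
    {a : complexBetti (projectiveSpace e.n ℂ) 2} (ha : IsRationalClass a) (ha0 : a ≠ 0)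
    {m : ℕ} (hm : 1 ≤ m) (hPm : P.dim = m + 1) (hd' : 0 < d) (hψ : ψ₀ ≫ ψ₀ = -(d • 𝟙 P))
    {ω : complexBetti P.X (2 + 2 * m)} (hω : IsRationalClass ω) (hω0 : ω ≠ 0)
    (J : (weilDatumOfKsymm hm hPm hd' hψ e ha ha0 hω hω0).Cx →ₗ[ℂ] (weilDatumOfKsymm hm hPm hd' hψ e ha ha0 hω hω0).Cx)
    (hW : Motives.IsWeilComplexStructure (weilDatumOfKsymm hm hPm hd' hψ e ha ha0 hω hω0).hForm J)
    (B : AbelianVariety ℂ) (Φ : B ⟶ B) (β : bettiCohomology P.X 1 ≃ₗ[ℚ] bettiCohomology B.X 1) : Prop :=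
  B.dim = 2 * n ∧ Φ ≫ Φ = -((d : ℤ) • 𝟙 B) ∧
    (∀ x, β (bettiCohomology.map ψ₀.hom.hom.hom 1 x) = bettiCohomology.map Φ.hom.hom.hom 1 (β x)) ∧
    ∀ x ∈ ((weilDatumOfKsymm hm hPm hd' hψ e ha ha0 hω hω0).hodgeStructure J hW.sq).piece 1 0,
      IsOfHodgeType (2 * n) B.X 1 1 0
        (Motives.ofRatClassBaseChange (ComplexPoints B.X) 1 (β.toLinearMap.baseChange ℂ x))

/-- RIEMANN'S EXISTENCE THEOREM AT WEIL TYPE `(n, n)`, discriminant `d` (statement of the transcendental stub). -/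
def RiemannRealisableAt (n d : ℕ) : Prop :=
  ∀ (P : AbelianVariety ℂ) (ψ₀ : P ⟶ P) (e : ProjectiveEmbedding P.X) (a : complexBetti (projectiveSpace e.n ℂ) 2),
    P.dim = 2 * n → ∀ (ha : IsRationalClass a) (ha0 : a ≠ 0), IsWeilType P ψ₀ n d →
    ∀ {m : ℕ} (hm : 1 ≤ m) (hPm : P.dim = m + 1) (hd' : 0 < d) (hψ : ψ₀ ≫ ψ₀ = -(d • 𝟙 P))
      {ω : complexBetti P.X (2 + 2 * m)} (hω : IsRationalClass ω) (hω0 : ω ≠ 0)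
      (J : (weilDatumOfKsymm hm hPm hd' hψ e ha ha0 hω hω0).Cx →ₗ[ℂ] (weilDatumOfKsymm hm hPm hd' hψ e ha ha0 hω hω0).Cx)
      (hW : Motives.IsWeilComplexStructure (weilDatumOfKsymm hm hPm hd' hψ e ha ha0 hω hω0).hForm J),
      ∃ (B : AbelianVariety ℂ) (Φ : B ⟶ B) (β : bettiCohomology P.X 1 ≃ₗ[ℚ] bettiCohomology B.X 1),
        RealisedBy n d P ψ₀ e ha ha0 hm hPm hd' hψ hω hω0 J hW B Φ β

/-- THE PERIOD-SURJECTIVE PACKAGE — VERBATIM the hypothesis of the venture's bridge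
`weilFamilyReach_similar_of_polarizedWeilSystems_of_periodSurjective`. [cite: Deligne1982HodgeCycles, proof of Thm. 4.8] -/
def PeriodPackage : Prop :=
  ∀ (n d : ℕ), 1 ≤ n → 1 ≤ d →
      ∀ (P : AbelianVariety ℂ) (ψ₀ : P ⟶ P) (e : ProjectiveEmbedding P.X)
        (a : complexBetti (projectiveSpace e.n ℂ) 2),
        P.dim = 2 * n → ∀ (ha : IsRationalClass a) (ha0 : a ≠ 0), IsWeilType P ψ₀ n d →
        ∃ (𝒳 S : SchemeOver ℂ) (f : 𝒳 ⟶ S) (s₀ : ComplexPoints S) (e' : P.X ≅ fiberOver f s₀)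
          (Y : ComplexPoints S → AbelianVariety ℂ) (Ψ : ∀ s, Y s ⟶ Y s)
          (ε : ∀ s, (Y s).X ≅ fiberOver f s) (H : complexBetti 𝒳 2),
          IsSmoothProjectiveFamily f (2 * n) ∧
          (∃ (N : ℕ) (ι : 𝒳 ⟶ CategoryTheory.MonoidalCategoryStruct.tensorObj (projectiveSpace N ℂ) S),
            AlgebraicGeometry.IsClosedImmersion ι.left ∧
              ι ≫ CategoryTheory.CartesianMonoidalCategory.snd (projectiveSpace N ℂ) S = f) ∧
          IrreducibleSpace S.left ∧ AlgebraicGeometry.Smooth S.hom ∧ IsQuasiProjectiveOver S ∧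
          (∀ s, (Y s).dim = 2 * n ∧ Ψ s ≫ Ψ s = -((d : ℤ) • 𝟙 (Y s))) ∧
          (∀ w : complexBetti P.X (2 * n), w ∈ weilClassesOf P ψ₀ n d →
            ∃ σ : ComplexPoints S → FiberClass f (2 * n),
              Continuous σ ∧ σ s₀ = ⟨s₀, complexBetti.map e'.inv (2 * n) w⟩ ∧
              ∀ s, ∃ x : complexBetti (fiberOver f s) (2 * n), σ s = ⟨s, x⟩ ∧
                IsOfHodgeType (2 * n) (fiberOver f s) (2 * n) n n x ∧
                complexBetti.map (ε s).hom (2 * n) x ∈ weilClassesOf (Y s) (Ψ s) n d) ∧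
          (∀ s : ComplexPoints S,
            IsRationalClass (complexBetti.map (fiberι f s) 2 H) ∧
              IsOfHodgeType (2 * n) (fiberOver f s) 2 1 1 (complexBetti.map (fiberι f s) 2 H)) ∧
          complexBetti.map e'.hom 2 (complexBetti.map (fiberι f s₀) 2 H) =
            (d : ℂ) • complexBetti.map e.ι 2 a + complexBetti.map ψ₀.hom.hom.hom 2 (complexBetti.map e.ι 2 a) ∧
          (∃ (m : ℕ) (hm : 1 ≤ m) (hPm : P.dim = m + 1) (hd' : 0 < d) (hψ : ψ₀ ≫ ψ₀ = -(d • 𝟙 P))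
              (ω : complexBetti P.X (2 + 2 * m)) (hω : IsRationalClass ω) (hω0 : ω ≠ 0),
            ∀ (J : (weilDatumOfKsymm hm hPm hd' hψ e ha ha0 hω hω0).Cx →ₗ[ℂ]
                (weilDatumOfKsymm hm hPm hd' hψ e ha ha0 hω hω0).Cx)
              (hW : Motives.IsWeilComplexStructure (weilDatumOfKsymm hm hPm hd' hψ e ha ha0 hω hω0).hForm J),
              ∃ (s : ComplexPoints S) (β : bettiCohomology P.X 1 ≃ₗ[ℚ] bettiCohomology (Y s).X 1),
                (∀ x, β (bettiCohomology.map ψ₀.hom.hom.hom 1 x) =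
                  bettiCohomology.map (Ψ s).hom.hom.hom 1 (β x)) ∧
                ∀ x ∈ ((weilDatumOfKsymm hm hPm hd' hψ e ha ha0 hω hω0).hodgeStructure J hW.sq).piece 1 0,
                  IsOfHodgeType (2 * n) (Y s).X 1 1 0
                    (Motives.ofRatClassBaseChange (ComplexPoints (Y s).X) 1 (β.toLinearMap.baseChange ℂ x)))

/-- THE ALGEBRAIC HALF (statement of the Riemann-free stub): the same package, but period-surjective only for REALISABLE
periods — a universal family COMPLETE for abelian varieties with `√-d`-multiplication marked on `H¹(P)`.
[cite: MumfordFogartyKirwan1994, Thm. 7.9–7.10] [cite: Deligne1982HodgeCycles, proof of Thm. 4.8 (pp. 48–51) and Rem. 4.9] -/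
def ModuliCompletePackage : Prop :=
  ∀ (n d : ℕ), 1 ≤ n → 1 ≤ d →
      ∀ (P : AbelianVariety ℂ) (ψ₀ : P ⟶ P) (e : ProjectiveEmbedding P.X)
        (a : complexBetti (projectiveSpace e.n ℂ) 2),
        P.dim = 2 * n → ∀ (ha : IsRationalClass a) (ha0 : a ≠ 0), IsWeilType P ψ₀ n d →
        ∃ (𝒳 S : SchemeOver ℂ) (f : 𝒳 ⟶ S) (s₀ : ComplexPoints S) (e' : P.X ≅ fiberOver f s₀)
          (Y : ComplexPoints S → AbelianVariety ℂ) (Ψ : ∀ s, Y s ⟶ Y s)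
          (ε : ∀ s, (Y s).X ≅ fiberOver f s) (H : complexBetti 𝒳 2),
          IsSmoothProjectiveFamily f (2 * n) ∧
          (∃ (N : ℕ) (ι : 𝒳 ⟶ CategoryTheory.MonoidalCategoryStruct.tensorObj (projectiveSpace N ℂ) S),
            AlgebraicGeometry.IsClosedImmersion ι.left ∧
              ι ≫ CategoryTheory.CartesianMonoidalCategory.snd (projectiveSpace N ℂ) S = f) ∧
          IrreducibleSpace S.left ∧ AlgebraicGeometry.Smooth S.hom ∧ IsQuasiProjectiveOver S ∧
          (∀ s, (Y s).dim = 2 * n ∧ Ψ s ≫ Ψ s = -((d : ℤ) • 𝟙 (Y s))) ∧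
          (∀ w : complexBetti P.X (2 * n), w ∈ weilClassesOf P ψ₀ n d →
            ∃ σ : ComplexPoints S → FiberClass f (2 * n),
              Continuous σ ∧ σ s₀ = ⟨s₀, complexBetti.map e'.inv (2 * n) w⟩ ∧
              ∀ s, ∃ x : complexBetti (fiberOver f s) (2 * n), σ s = ⟨s, x⟩ ∧
                IsOfHodgeType (2 * n) (fiberOver f s) (2 * n) n n x ∧
                complexBetti.map (ε s).hom (2 * n) x ∈ weilClassesOf (Y s) (Ψ s) n d) ∧
          (∀ s : ComplexPoints S,
            IsRationalClass (complexBetti.map (fiberι f s) 2 H) ∧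
              IsOfHodgeType (2 * n) (fiberOver f s) 2 1 1 (complexBetti.map (fiberι f s) 2 H)) ∧
          complexBetti.map e'.hom 2 (complexBetti.map (fiberι f s₀) 2 H) =
            (d : ℂ) • complexBetti.map e.ι 2 a + complexBetti.map ψ₀.hom.hom.hom 2 (complexBetti.map e.ι 2 a) ∧
          (∃ (m : ℕ) (hm : 1 ≤ m) (hPm : P.dim = m + 1) (hd' : 0 < d) (hψ : ψ₀ ≫ ψ₀ = -(d • 𝟙 P))
              (ω : complexBetti P.X (2 + 2 * m)) (hω : IsRationalClass ω) (hω0 : ω ≠ 0),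
            ∀ (J : (weilDatumOfKsymm hm hPm hd' hψ e ha ha0 hω hω0).Cx →ₗ[ℂ]
                (weilDatumOfKsymm hm hPm hd' hψ e ha ha0 hω hω0).Cx)
              (hW : Motives.IsWeilComplexStructure (weilDatumOfKsymm hm hPm hd' hψ e ha ha0 hω hω0).hForm J),
              (∃ (B : AbelianVariety ℂ) (Φ : B ⟶ B) (β : bettiCohomology P.X 1 ≃ₗ[ℚ] bettiCohomology B.X 1),
                  RealisedBy n d P ψ₀ e ha ha0 hm hPm hd' hψ hω hω0 J hW B Φ β) →
              ∃ (s : ComplexPoints S) (β : bettiCohomology P.X 1 ≃ₗ[ℚ] bettiCohomology (Y s).X 1),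
                (∀ x, β (bettiCohomology.map ψ₀.hom.hom.hom 1 x) =
                  bettiCohomology.map (Ψ s).hom.hom.hom 1 (β x)) ∧
                ∀ x ∈ ((weilDatumOfKsymm hm hPm hd' hψ e ha ha0 hω hω0).hodgeStructure J hW.sq).piece 1 0,
                  IsOfHodgeType (2 * n) (Y s).X 1 1 0
                    (Motives.ofRatClassBaseChange (ComplexPoints (Y s).X) 1 (β.toLinearMap.baseChange ℂ x)))

/-- STUB (open, load-bearing, XL): the ALGEBRAIC half — fine PEL moduli with level structure, its universal family with
flat Weil sections and polarization class, complete for realisable periods. [cite: MumfordFogartyKirwan1994, Thm. 7.9–7.10]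
[cite: Deligne1982HodgeCycles, proof of Thm. 4.8 (pp. 48–51) and Rem. 4.9] [cite: vanGeemen1994HodgeAV, 5.8–5.11] -/
theorem stub_moduliComplete : ModuliCompletePackage := by
  sorry

/-- STUB (open, load-bearing, XL): the TRANSCENDENTAL half — Riemann's existence theorem at Weil type, every `n, d ≥ 1`.
[cite: Mumford1970AbelianVarieties, §1–§3] [cite: BirkenhakeLange2004, Thm. 4.2.1] [cite: Deligne1982HodgeCycles, Prop. 4.4 and Lemma 4.6] -/
theorem stub_riemannRealisable : ∀ (n d : ℕ), 1 ≤ n → 1 ≤ d → RiemannRealisableAt n d := by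
  sorry

/-- GLUE (proved): moduli-complete ∧ Riemann-realisable ⟹ the period-surjective package. -/
theorem periodPackage_of (hM : ModuliCompletePackage) (hR : ∀ (n d : ℕ), 1 ≤ n → 1 ≤ d → RiemannRealisableAt n d) :
    PeriodPackage := by
  intro n d hn hd P ψ₀ e a hP ha ha0 hWT
  obtain ⟨𝒳, S, f, s₀, e', Y, Ψ, ε, H, h1, h2, h3, h4, h5, h6, h7, h8, h9, m, hm, hPm, hd', hψ, ω, hω, hω0, hU⟩ :=
    hM n d hn hd P ψ₀ e a hP ha ha0 hWT
  exact ⟨𝒳, S, f, s₀, e', Y, Ψ, ε, H, h1, h2, h3, h4, h5, h6, h7, h8, h9, m, hm, hPm, hd', hψ, ω, hω, hω0,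
    fun J hW => hU J hW (hR n d hn hd P ψ₀ e a hP ha ha0 hWT hm hPm hd' hψ hω hω0 J hW)⟩

/-- RUNG STUB (open, first prover target, L): Riemann realisability for Weil-type abelian SURFACES (`n = 1`).
[cite: Shimura1963AnalyticFamilies, §4] [cite: BirkenhakeLange2004, Thm. 4.2.1] -/
theorem stub_rung_riemannSurfaces : ∀ (d : ℕ), 1 ≤ d → RiemannRealisableAt 1 d := by
  sorry

/-- Remark (sorry-free): the sub-rung IS the `n = 1` case of the transcendental stub's statement. -/
theorem subrung_of_stub (h : ∀ (n d : ℕ), 1 ≤ n → 1 ≤ d → RiemannRealisableAt n d) :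
    ∀ (d : ℕ), 1 ≤ d → RiemannRealisableAt 1 d :=
  fun d hd => h 1 d le_rfl hd

/-- THE BRIDGE (proved; the venture's `Summit.Ventures.HSemireg.weilFamilyReach_hyperbolic_of_polarizedWeilSystems_of_periodSurjective`
re-proved inline because that venture module is outside the farm build): hyperbolic members are of Weil type and lie in the
split discriminant class `[(-1)ⁿ]`, so the period-surjective package gives the hyperbolic reach fact.
[cite: Deligne1982HodgeCycles, §4 Cor. 4.2, Prop. 4.4 and proof of Thm. 4.8] [cite: vanGeemen1994HodgeAV, Lemma 5.2 and (5.4.1)] -/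
theorem hyperbolic_of_periodPackage (h : PeriodPackage) : weilFamilyReach_hyperbolic := by
  intro n d hn hd P ψ₀ e a hP hψ ha ha0 hhyp w hw hw0 A φ eA aA hA hφ haA haA0 hhypA
  have hn0 : 0 < n := hn
  have hd0 : 0 < d := hd
  have hWP : IsWeilType P ψ₀ n d := isWeilType_of_isHyperbolicWeilType hn0 hd0 hP hψ e ha ha0 hhyp
  have hWA : IsWeilType A φ n d := isWeilType_of_isHyperbolicWeilType hn0 hd0 hA hφ eA haA haA0 hhypA
  have hδP := hasWeilDiscriminantNondeg_neg_one_pow_of_isHyperbolicWeilType hn0 hP hd0 hψ e ha ha0 hhyp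
  have hδA := hasWeilDiscriminantNondeg_neg_one_pow_of_isHyperbolicWeilType hn0 hA hd0 hφ eA haA haA0 hhypA
  obtain ⟨cP, hcPw, hcP0, -⟩ := exists_isRationalClass_ne_zero_mem_weilClassesOf hWP.pos hWP.dim_eq hWP.d_pos hWP.sq_eq
  obtain ⟨cA, hcAw, hcA0, -⟩ := exists_isRationalClass_ne_zero_mem_weilClassesOf hWA.pos hWA.dim_eq hWA.d_pos hWA.sq_eq
  obtain ⟨𝒳, S, f, s₀, e', Y, Ψ, ε, H, hfam, hemb, hirr, hsm, hqp, hYΨ, hsec, hH, hH₀, hU⟩ :=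
    h n d hn hd P ψ₀ e a hP ha ha0 hWP
  exact weilFamilyReaches_of_polarizedWeilSystemAt_of_periodSurjective hn hP e ha ha0
    ⟨cP, hcPw, hcP0, hWP.isOfHodgeType_of_mem_weilClassesOf hcPw⟩ hδP f e' Y Ψ ε hfam hemb hirr hsm hqp hYΨ hsec
    hH hH₀ hU hA hφ eA haA haA0 ⟨cA, hcAw, hcA0, hWA.isOfHodgeType_of_mem_weilClassesOf hcAw⟩ hδA hw hw0

/-- **Composition** (the ONLY theorem of this file concluding the crux): the two halves give `ReachHyperbolic` BY NAME. -/
theorem ReachHyperbolic_of :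
    Summit.HodgeConjecture.HodgeConjecture.Theses.EightfoldTwistedSheafSeeds.ReachHyperbolic :=
  hyperbolic_of_periodPackage (periodPackage_of stub_moduliComplete stub_riemannRealisable)

end Summit.HodgeConjecture.HodgeConjecture.Cruxes.ReachHyperbolic.ModuliRiemann

end
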